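import Summits.BirchSwinnertonDyer.Rank1Residual.GaloisImage.CongruenceVisibilityTwistedCocycle
import Literature.NumberTheory.EllipticCurves.CongruenceVisibilityLocalFactors
import HarnessLib

/-!
# Two points independent modulo `3E(K)` from `rank E(K) ≥ 2` (the rank-currency conversion for
# THEOREM B records) (cell `b2b-bsdres`, team n1011, seat p10 GEN 9; ROW T-VIS3-UC-IOTA FILE 6;
# skeleton `cells/n1011/skel/T-VIS3-UC-IOTA.md`; r1 ROUTE-1 §52 (ii))

HONEST FRAMING (cell `b2b-bsdres`, run/shared/lean/b2b/bsd-rank1-residual/, verbatim in every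
file): the goal of the cell is to DELETE the COMBINATION-SHAPED residual classes of the
Birch–Swinnerton-Dyer formula for ALL analytic-rank `≤ 1` elliptic curves over `ℚ` — "full BSD
formula for every rank `≤ 1` curve in class `C`" assembled STRICTLY from published theorems — so
that the rank-`≤ 1` remainder becomes exactly the CONSTRUCTION-SHAPED classes, which are TYPED
(missing-input `Prop`s), NOT attempted. This is not "finishing BSD". Team n1011 (N10 / N11):
research route on the CONSTRUCTION-SHAPED class X4 (§I N11 LOWER half); no claim beyond the
stated classes; nothing is booked; marks UNCHANGED. Theorems only: no definition, no named fact,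
no `sorry`. TOOL theorems; they close nothing by themselves.

## What

THEOREM B's record shapes in the WITNESS currency (FILE 8b/8d
`exists_sha_ne_zero_of_congr_of_identityComponent[_rat]`, n1011-p04's places₇ twin
`…_of_identityComponent_rat_of_places₇`) display two points `P₁ P₂ ∈ E'(K)` with
`hind : ∀ c₁ c₂, c₁ • P₁ + c₂ • P₂ ∈ 3E'(K) → 3 ∣ c₁ ∧ 3 ∣ c₂`. Every other visibility record of
the cell displays `hrank : 2 ≤ rank E'` instead. This file converts:
* `exists_pair_indep_of_three_lt_index` — in any abelian group `A` with `[A : 3A] > 3` there are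
  `P₁, P₂` with `hind` (pick `P₁ ∉ 3A`; `N₁ = 3A + ℤP₁` has `[N₁ : 3A] ≤ 3` by the collision lemma of
  FILE 1a, so `N₁ ≠ A`; pick `P₂ ∉ N₁`);
* `exists_pair_indep_of_two_le_mordellWeilRank` — for an elliptic curve over a number field,
  `2 ≤ rank E(K) ⇒ ∃ P₁ P₂, hind` (`9 ≤ 3^{rank} ≤ [E(K) : 3E(K)]`, tree
  `pow_mordellWeilRank_le_index_range_zsmul`, Mordell–Weil).
References: [SilvermanAEC2009] VIII.6 (Mordell–Weil); [CremonaMazur2000] §3. -/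

noncomputable section

open scoped Classical

namespace Summit.BirchSwinnertonDyer.Rank1Residual.GaloisImage.TwistedWitness

open WeierstrassCurve Literature.NumberTheory.EllipticCurves

/-- **Two elements independent modulo `3A` when `[A : 3A] > 3`.** [folklore] -/
theorem exists_pair_indep_of_three_lt_index {A : Type*} [AddCommGroup A]
    (h3 : 3 < (zsmulAddGroupHom ((3 : ℕ) : ℤ) : A →+ A).range.index) :
    ∃ P₁ P₂ : A, ∀ c₁ c₂ : ℤ, c₁ • P₁ + c₂ • P₂ ∈
      (zsmulAddGroupHom ((3 : ℕ) : ℤ) : A →+ A).range → (3 : ℤ) ∣ c₁ ∧ (3 : ℤ) ∣ c₂ := by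
  set R := (zsmulAddGroupHom ((3 : ℕ) : ℤ) : A →+ A).range with hR
  have hmemR : ∀ x : A, x ∈ R ↔ ∃ y : A, (3 : ℤ) • y = x := fun x ↦ by
    rw [hR, AddMonoidHom.mem_range]
    exact ⟨fun ⟨y, hy⟩ ↦ ⟨y, by simpa using hy⟩, fun ⟨y, hy⟩ ↦ ⟨y, by simpa using hy⟩⟩
  have h3R : ∀ y : A, (3 : ℤ) • y ∈ R := fun y ↦ (hmemR _).mpr ⟨y, rfl⟩
  -- `c • P ∈ R` with `3 ∤ c` forces `P ∈ R` (and the same modulo any subgroup containing `R`)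
  have hkey : ∀ (N : AddSubgroup A), R ≤ N → ∀ (P : A) (c : ℤ), c • P ∈ N → ¬ (3 : ℤ) ∣ c → P ∈ N := by
    intro N hRN P c hc hndvd
    have hr : c % 3 = 1 ∨ c % 3 = 2 := by omega
    rcases hr with h1 | h2
    · have : P = c • P - (3 : ℤ) • ((c / 3) • P) := by
        rw [smul_smul, ← sub_smul, show c - 3 * (c / 3) = 1 by omega, one_smul]
      rw [this]; exact N.sub_mem hc (hRN (h3R _))
    · have : P = (3 : ℤ) • (((c / 3) + 1) • P) - c • P := by
        rw [smul_smul, ← sub_smul, show 3 * (c / 3 + 1) - c = 1 by omega, one_smul]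
      rw [this]; exact N.sub_mem (hRN (h3R _)) hc
  -- `P₁ ∉ R`
  have hRtop : R ≠ ⊤ := fun h ↦ by rw [h, AddSubgroup.index_top] at h3; omega
  obtain ⟨P₁, hP₁⟩ : ∃ P₁ : A, P₁ ∉ R :=
    not_forall.mp (fun h ↦ hRtop ((AddSubgroup.eq_top_iff' R).mpr h))
  -- `N₁ = R + ℤP₁` has `[N₁ : R] ≤ 3`, hence `N₁ ≠ ⊤`
  set N₁ : AddSubgroup A := R ⊔ AddSubgroup.zmultiples P₁ with hN₁
  have hle : R ≤ N₁ := le_sup_left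
  have hrel : R.relIndex N₁ ≤ 3 := by
    refine relIndex_le_of_forall_exists_sub_mem R N₁ 3 (fun f hf ↦ ?_)
    choose r hr k hk using fun i ↦ (AddSubgroup.mem_sup.mp (hf i))
    -- `hk i : k i ∈ zmultiples P₁ ∧ r i + k i = f i`
    choose m hm using fun i ↦ AddSubgroup.mem_zmultiples_iff.mp (hk i).1
    obtain ⟨i, j, hij, hq⟩ := Fintype.exists_ne_map_eq_of_card_lt (fun i ↦ ((m i : ℤ) : ZMod 3))
      (by rw [ZMod.card, Fintype.card_fin]; norm_num)
    refine ⟨i, j, hij, ?_⟩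
    have hd : (3 : ℤ) ∣ (m i - m j) := by
      have := (ZMod.intCast_eq_intCast_iff_dvd_sub (m j) (m i) 3).mp hq.symm
      simpa using this
    obtain ⟨d, hd⟩ := hd
    rw [← (hk i).2, ← (hk j).2, ← hm i, ← hm j]
    have e : r i + m i • P₁ - (r j + m j • P₁) = (r i - r j) + (m i - m j) • P₁ := by
      rw [sub_zsmul]; abel
    rw [e, hd, mul_zsmul]
    exact R.add_mem (R.sub_mem (hr i) (hr j)) (h3R _)
  have hN₁top : N₁ ≠ ⊤ := by
    intro h
    have hmul := AddSubgroup.relIndex_mul_index hle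
    rw [h, AddSubgroup.index_top, mul_one, AddSubgroup.relIndex_top_right] at hmul
    rw [h, AddSubgroup.relIndex_top_right] at hrel
    omega
  obtain ⟨P₂, hP₂⟩ : ∃ P₂ : A, P₂ ∉ N₁ :=
    not_forall.mp (fun h ↦ hN₁top ((AddSubgroup.eq_top_iff' N₁).mpr h))
  refine ⟨P₁, P₂, fun c₁ c₂ hc ↦ ?_⟩
  -- `3 ∣ c₂`: otherwise `P₂ ∈ N₁`
  have hc₂ : (3 : ℤ) ∣ c₂ := by
    by_contra hnd
    apply hP₂
    refine hkey N₁ hle P₂ c₂ ?_ hnd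
    have e : c₂ • P₂ = (c₁ • P₁ + c₂ • P₂) - c₁ • P₁ := by abel
    rw [e]
    exact N₁.sub_mem (hle hc) (AddSubgroup.mem_sup_right (AddSubgroup.zsmul_mem_zmultiples P₁ c₁))
  refine ⟨?_, hc₂⟩
  by_contra hnd
  apply hP₁
  refine hkey R le_rfl P₁ c₁ ?_ hnd
  obtain ⟨d, rfl⟩ := hc₂
  have e : c₁ • P₁ = (c₁ • P₁ + (3 * d) • P₂) - (3 : ℤ) • (d • P₂) := by rw [mul_zsmul]; abel
  rw [e]
  exact R.sub_mem hc (h3R _)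

/-- **`2 ≤ rank E(K)` gives two points independent modulo `3E(K)`** (over a number field;
`9 ≤ 3^{rank} ≤ [E(K) : 3E(K)]` by Mordell–Weil, tree `pow_mordellWeilRank_le_index_range_zsmul`).
The rank-currency input of THEOREM B's witness-form records. [cite: SilvermanAEC2009, VIII.6] -/
theorem exists_pair_indep_of_two_le_mordellWeilRank {K : Type} [Field K] [NumberField K]
    (W : WeierstrassCurve K) [W.IsElliptic] (hrank : 2 ≤ W.mordellWeilRank) :
    ∃ P₁ P₂ : W.toAffine.Point, ∀ c₁ c₂ : ℤ, c₁ • P₁ + c₂ • P₂ ∈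
      (zsmulAddGroupHom ((3 : ℕ) : ℤ) : W.toAffine.Point →+ W.toAffine.Point).range →
      (3 : ℤ) ∣ c₁ ∧ (3 : ℤ) ∣ c₂ := by
  apply exists_pair_indep_of_three_lt_index
  calc 3 < 3 ^ 2 := by norm_num
    _ ≤ 3 ^ W.mordellWeilRank := Nat.pow_le_pow_right (by norm_num) hrank
    _ ≤ _ := pow_mordellWeilRank_le_index_range_zsmul W (by norm_num)

/-- **The same over `ℚ`**, stated with `ℚ`'s decidable equality on `E(ℚ)` (the form FILE 8d's
`…_identityComponent_rat` and n1011-p04's places₇ twin display), converted from the classical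
group law (`Subsingleton (DecidableEq ℚ)`). [cite: SilvermanAEC2009, VIII.6] -/
theorem exists_pair_indep_of_two_le_mordellWeilRank_rat (W : WeierstrassCurve ℚ) [W.IsElliptic]
    (hrank : 2 ≤ W.mordellWeilRank) :
    ∃ P₁ P₂ : W.toAffine.Point, ∀ c₁ c₂ : ℤ, c₁ • P₁ + c₂ • P₂ ∈
      (zsmulAddGroupHom ((3 : ℕ) : ℤ) : W.toAffine.Point →+ W.toAffine.Point).range →
      (3 : ℤ) ∣ c₁ ∧ (3 : ℤ) ∣ c₂ := by
  obtain ⟨P₁, P₂, h⟩ := exists_pair_indep_of_two_le_mordellWeilRank W hrank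
  exact ⟨P₁, P₂, fun c₁ c₂ hc ↦ h c₁ c₂ (by convert hc)⟩

end Summit.BirchSwinnertonDyer.Rank1Residual.GaloisImage.TwistedWitness

end
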